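import Literature.Analysis.FluidPDE.TransportWeakExistence
import Literature.Analysis.FluidPDE.PassiveScalarExistenceProofs
import Literature.Analysis.FluidPDE.PassiveScalarUniquenessBounded
import Literature.Analysis.FluidPDE.PassiveScalarSteadyTest
import Literature.Analysis.FluidPDE.TransportGalerkinExistence
import Literature.Analysis.FunctionSpaces.SpaceTimeWeakCompactness
import HarnessLib

/-!
# Weak transport by a bounded divergence-free field: vanishing viscosity and the weakly
  continuous representative (discharge of `Torus.BardosTitiWiedemann2012_transportExistence`)

Analysis/FluidPDE proof file (everything proved). The named fact
`Torus.BardosTitiWiedemann2012_transportExistence` (`TransportWeakExistence`; Bardos–Titi–Wiedemann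
2012, proof of Cor. 2; DiPerna–Lions 1989, Prop. II.1; De Lellis–Székelyhidi 2010, Lemma 7.1) asks,
for `T > 0`, a BOUNDED measurable velocity `b` weakly divergence free at a.e. time and
`w₀ ∈ L²(T^d)`, for a weak solution of `∂ₜw + b·∇w = 0` on `T^d × [0,T)` in the DiPerna–Lions
class with the `C([0,T];L²_w)` representative, `‖w(t)‖_{L²} ≤ ‖w₀‖_{L²}` for every `t` and
`w(0) = w₀`. The tree proves it for velocities that are moreover weakly continuous in time
(`Torus.transportExistence_of_weaklyContinuous`, Fourier–Galerkin). This file proves it in general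
(`Torus.BardosTitiWiedemann2012_transportExistence_holds`), by **vanishing viscosity** instead of a
Galerkin scheme, following DiPerna–Lions 1989, Prop. II.1 and the Remark after it:

* §1 `exists_isWeakScalarTransportOn_zero_of_memLp_top`: for `κₙ = 1/(n+1)` the tree's weak
  solutions `θₙ` of `∂ₜθ + b·∇θ = κₙΔθ` (`exists_isWeakScalarTransportOn_holds`, bounded drift) obey
  `‖θₙ(t)‖_{L²} ≤ ‖w₀‖_{L²}` for a.e. `t` (`IsWeakScalarTransportOn.ae_lintegral_sq_le_of_memLp_top`,
  the energy inequality of the bounded-drift class), so a subsequence converges weak-* in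
  `L^∞(0,T;L²)` (`exists_strictMono_weakLimit_of_lintegral_sq_le`); the limit is a weak solution
  of the transport equation (`κ = 0`) with the same drift and datum — the weak formulation is
  linear, the drift is FIXED, and the diffusion term `κₙ ∫∫ θₙ Δψ → 0` — and inherits the a.e.
  bound `∫ |w(t)|² ≤ ∫ |w₀|²` (DiPerna–Lions 1989, Prop. II.1; Evans 2010, §7.3.2 b).
* §2 transfer tools: modification of a weak solution on a null set of times
  (`IsWeakScalarTransportOn.congr_ae_slice`); a.e. versus everywhere on `[0,T]` for continuous
  functions.
* §3 fields with prescribed, continuous Fourier coefficients: `L²` bound (Parseval) and weak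
  continuity in time against `L²` (`continuousOn_integral_mul_of_coeff`, the argument of
  `IsGalerkinLimit.continuousOn_integral_mul`; De Lellis–Székelyhidi 2010, Lemma 7.1 / App. A).
* §4 `IsWeakScalarTransportOn.exists_continuous_coeff`: the pairings of a weak solution with the
  cosine and sine modes have absolutely continuous representatives (`ae_integral_mul_eq`,
  DiPerna–Lions 1989, (14)), giving a coefficient family `c(t)` continuous in `t`, equal to
  `𝓕(θ(t))` for a.e. `t` and to `𝓕θ₀` at `t = 0`, with the finite Bessel sums and the reality
  condition for EVERY `t` (continuity + a.e.); `exists_realScalarField_forall_mFourierCoeff_eq`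
  realises it by a jointly measurable real field with `𝓕(w(t)) = c(t)` for every `t ≥ 0`
  (parametrised Riesz–Fischer, `exists_realField_forall_mFourierCoeff_eq`, positive dimension).
* §5 assembly: the representative agrees with the vanishing-viscosity solution at a.e. time
  (uniqueness of Fourier coefficients), hence is a weak solution (§2), is weakly continuous with
  `∫ w(t)² ≤ ∫ w₀²` on `[0,T]` (§3), and its slice `t = 0` — equal to `w₀` a.e. — is replaced by
  `w₀` (`transportExistence_of_memLp_top`); the degenerate case `d = ∅` is the field constant in
  time (`transportExistence_of_isEmpty`, conservation of the mean).

## References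

* C. Bardos, E. S. Titi, E. Wiedemann, C. R. Math. Acad. Sci. Paris 350 (2012) 757–760, proof of
  Cor. 2. [`BardosTitiWiedemann2012`]
* R. J. DiPerna, P.-L. Lions, Invent. Math. 98 (1989) 511–547, §II.1, Prop. II.1, (14).
  [`DiPernaLions1989`]
* C. De Lellis, L. Székelyhidi Jr., Arch. Ration. Mech. Anal. 195 (2010) 225–260, Lemma 7.1,
  Appendix A. [`DeLellisSzekelyhidi2010`]
* J. C. Robinson, J. L. Rodrigo, W. Sadowski, *The Three-Dimensional Navier–Stokes Equations*
  (CUP 2016), Thm. 4.11. [`RobinsonRodrigoSadowski2016`]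
* L. C. Evans, *Partial Differential Equations*, 2nd ed. (AMS 2010), §7.3.2. [`Evans2010`]
* L. Grafakos, *Classical Fourier Analysis*, 3rd ed. (Springer 2014), Prop. 3.2.4. [`Grafakos2014`]
-/

noncomputable section

open MeasureTheory TopologicalSpace Set Function Filter Metric UnitAddTorus
open _root_.Topology
open scoped ENNReal NNReal InnerProductSpace ComplexConjugate

namespace Literature.Analysis.FluidPDE

namespace Torus

variable {d : Type*} [Fintype d]

/-! ## §1 The vanishing-viscosity weak solution -/

section VanishingViscosity

omit [Fintype d] in
/-- `a ≤ 1 + a²` in `ℝ≥0∞`. [folklore] -/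
private theorem ennreal_le_one_add_sq (a : ℝ≥0∞) : a ≤ 1 + a ^ 2 := by
  rcases le_total a 1 with h | h
  · exact h.trans le_self_add
  · calc a = a * 1 := (mul_one a).symm
      _ ≤ a * a := by gcongr
      _ = a ^ 2 := (sq a).symm
      _ ≤ 1 + a ^ 2 := le_add_self

/-- **Weak transport solutions by vanishing viscosity.** For `T > 0`, an `L²` datum `θ₀` and a
bounded velocity field `u ∈ L^∞((0,T) × T^d)` which is weakly divergence free at a.e. time, there
is a weak solution `θ ∈ L^∞(0,T;L²)` of the transport equation `∂ₜθ + u·∇θ = 0` on `T^d × [0,T)`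
with datum `θ₀` (`IsWeakScalarTransportOn T 0 u θ₀ θ`) obeying `∫ |θ(t)|² ≤ ∫ |θ₀|²` for a.e.
`t ∈ (0,T)`: the weak solutions `θₙ` of `∂ₜθ + u·∇θ = κₙΔθ`, `κₙ = 1/(n+1)`
(`exists_isWeakScalarTransportOn_holds`) satisfy `‖θₙ(t)‖_{L²} ≤ ‖θ₀‖_{L²}` a.e.
(`IsWeakScalarTransportOn.ae_lintegral_sq_le_of_memLp_top`), a subsequence converges weak-* in
`L^∞(0,T;L²)` (`exists_strictMono_weakLimit_of_lintegral_sq_le`), and the limit solves the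
transport equation since the weak formulation is linear with a fixed drift and
`κₙ ∫∫ θₙ Δψ → 0`. [cite: DiPernaLions1989, Prop. II.1] -/
theorem exists_isWeakScalarTransportOn_zero_of_memLp_top {T : ℝ} (hT : 0 < T)
    {u : ℝ → UnitAddTorus d → EuclideanSpace ℝ d} {θ₀ : UnitAddTorus d → ℝ} (hθ₀ : MemLp θ₀ 2 volume)
    (hu : MemLp (FunctionSpaces.Torus.stLift u) ⊤ (volume.restrict (Ioo 0 T ×ˢ univ)))
    (hdiv : ∀ᵐ t ∂(volume.restrict (Ioo 0 T)), FunctionSpaces.Torus.IsWeaklyDivFree (u t)) :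
    ∃ θ : ℝ → UnitAddTorus d → ℝ, IsWeakScalarTransportOn T 0 u θ₀ θ ∧
      ∀ᵐ t ∂(volume.restrict (Ioo 0 T)), ∫⁻ x, ‖θ t x‖ₑ ^ 2 ≤ ∫⁻ x, ‖θ₀ x‖ₑ ^ 2 := by
  set μ : Measure (ℝ × UnitAddTorus d) :=
    ((volume : Measure ℝ).restrict (Ioo 0 T)).prod (volume : Measure (UnitAddTorus d)) with hμ
  haveI : IsFiniteMeasure ((volume : Measure ℝ).restrict (Ioo 0 T)) :=
    isFiniteMeasure_restrict.2 measure_Ioo_lt_top.ne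
  haveI : IsFiniteMeasure μ := by rw [hμ]; infer_instance
  -- the viscous approximants
  set κ : ℕ → ℝ := fun n => 1 / ((n : ℝ) + 1) with hκ
  have hκpos : ∀ n, 0 < κ n := fun n => by positivity
  have hκlim : Tendsto κ atTop (𝓝 0) := tendsto_one_div_add_atTop_nhds_zero_nat
  have hex : ∀ n, ∃ θ : ℝ → UnitAddTorus d → ℝ, IsWeakScalarTransportOn T (κ n) u θ₀ θ := by
    intro n
    obtain ⟨θ, hθ, -⟩ := exists_isWeakScalarTransportOn_holds (hκpos n) hθ₀ hu hdiv
    exact ⟨θ, hθ⟩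
  choose θ hsol using hex
  -- the uniform `L^∞_t L²_x` bound `∫ |θₙ(t)|² ≤ ∫ |θ₀|²`
  have hfin₀ : ∫⁻ x, ‖θ₀ x‖ₑ ^ 2 < ⊤ := by
    rw [← FunctionSpaces.eLpNorm_two_pow_two_eq_lintegral]
    exact ENNReal.pow_lt_top hθ₀.eLpNorm_lt_top
  set C : ℝ≥0 := (∫⁻ x, ‖θ₀ x‖ₑ ^ 2).toNNReal with hC
  have hCeq : (C : ℝ≥0∞) = ∫⁻ x, ‖θ₀ x‖ₑ ^ 2 := ENNReal.coe_toNNReal hfin₀.ne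
  have hbd : ∀ n, ∀ᵐ t ∂(volume.restrict (Ioo 0 T)), ∫⁻ x, ‖θ n t x‖ₑ ^ 2 ≤ C := by
    intro n
    filter_upwards [(hsol n).ae_lintegral_sq_le_of_memLp_top (hκpos n) hθ₀ hu] with t ht
    rwa [hCeq]
  -- weak-* compactness
  obtain ⟨φ, hφ, W, hWm, hWb, hWlim⟩ :=
    FunctionSpaces.Torus.exists_strictMono_weakLimit_of_lintegral_sq_le (fun n => (hsol n).aestronglyMeasurable) hbd
  refine ⟨W, ?_, by simpa only [hCeq] using hWb⟩
  -- the drift: a.e. bounds and measurability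
  obtain ⟨Cu, hCu0, hCu⟩ := ae_norm_le_prod_of_memLp_top_stLift hu
  obtain ⟨Cu', -, hCu'⟩ := ae_ae_norm_le_of_memLp_top_stLift hu
  have hum : AEStronglyMeasurable (uncurry u) μ :=
    FunctionSpaces.Torus.aestronglyMeasurable_uncurry_of_stLift_prod hu.1
  have hWm' : AEStronglyMeasurable (uncurry W) μ :=
    FunctionSpaces.Torus.aestronglyMeasurable_uncurry_of_stLift_prod hWm
  have hu2 : ∀ᵐ t ∂(volume.restrict (Ioo 0 T)), ∫⁻ x, ‖u t x‖ₑ ^ 2 ≤ ENNReal.ofReal Cu' ^ 2 := by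
    filter_upwards [hCu'] with t ht
    calc ∫⁻ x, ‖u t x‖ₑ ^ 2 ≤ ∫⁻ _ : UnitAddTorus d, ENNReal.ofReal Cu' ^ 2 := by
          refine lintegral_mono_ae ?_
          filter_upwards [ht] with x hx
          gcongr
          rw [← ofReal_norm]
          exact ENNReal.ofReal_le_ofReal hx
      _ = ENNReal.ofReal Cu' ^ 2 := by rw [lintegral_const, measure_univ, mul_one]
  refine ⟨hWm, hu.1, ⟨C, hWb⟩, ?_, ?_, hdiv, fun ψ hψ => ?_⟩
  · -- `u ∈ L¹(0,T; L²)`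
    calc ∫⁻ t in Ioo 0 T, (∫⁻ x, ‖u t x‖ₑ ^ 2) ^ (1 / 2 : ℝ)
        ≤ ∫⁻ _ in Ioo 0 T, (ENNReal.ofReal Cu' ^ 2) ^ (1 / 2 : ℝ) := by
          refine lintegral_mono_ae ?_
          filter_upwards [hu2] with t ht
          exact ENNReal.rpow_le_rpow ht (by norm_num)
      _ < ⊤ := by
          rw [lintegral_const, Measure.restrict_apply_univ]
          exact ENNReal.mul_lt_top (ENNReal.rpow_lt_top_of_nonneg (by norm_num)
            (ENNReal.pow_ne_top ENNReal.ofReal_ne_top)) measure_Ioo_lt_top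
  · -- `u W ∈ L¹((0,T) × T^d)`
    have hWs : ∀ᵐ t ∂(volume.restrict (Ioo 0 T)), AEStronglyMeasurable (W t) volume := hWm'.prodMk_left
    calc ∫⁻ t in Ioo 0 T, ∫⁻ x, ‖u t x‖ₑ * ‖W t x‖ₑ
        ≤ ∫⁻ _ in Ioo 0 T, ENNReal.ofReal Cu' * (C : ℝ≥0∞) ^ (1 / 2 : ℝ) := by
          refine lintegral_mono_ae ?_
          filter_upwards [hCu', hWb, hWs] with t ht htW htm
          calc ∫⁻ x, ‖u t x‖ₑ * ‖W t x‖ₑ ≤ ∫⁻ x, ENNReal.ofReal Cu' * ‖W t x‖ₑ := by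
                refine lintegral_mono_ae ?_
                filter_upwards [ht] with x hx
                gcongr
                rw [← ofReal_norm]
                exact ENNReal.ofReal_le_ofReal hx
            _ = ENNReal.ofReal Cu' * eLpNorm (W t) 1 volume := by
                rw [lintegral_const_mul' _ _ ENNReal.ofReal_ne_top, eLpNorm_one_eq_lintegral_enorm]
            _ ≤ ENNReal.ofReal Cu' * eLpNorm (W t) 2 volume := by
                gcongr
                exact eLpNorm_le_eLpNorm_of_exponent_le one_le_two htm
            _ ≤ ENNReal.ofReal Cu' * (C : ℝ≥0∞) ^ (1 / 2 : ℝ) := by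
                gcongr
                rw [FunctionSpaces.eLpNorm_two_eq_pow_two_rpow_half, FunctionSpaces.eLpNorm_two_pow_two_eq_lintegral]
                exact ENNReal.rpow_le_rpow htW (by norm_num)
      _ < ⊤ := by
          rw [lintegral_const, Measure.restrict_apply_univ]
          exact ENNReal.mul_lt_top (ENNReal.mul_lt_top ENNReal.ofReal_lt_top
            (ENNReal.rpow_lt_top_of_nonneg (by norm_num) ENNReal.coe_ne_top)) measure_Ioo_lt_top
  · -- the weak formulation in the limit
    set G : ℝ → UnitAddTorus d → ℝ := fun t x =>
      FunctionSpaces.Torus.timeDeriv ψ t x + ⟪u t x, FunctionSpaces.Torus.gradient (ψ t) x⟫_ℝ +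
        0 * FunctionSpaces.Torus.laplacian (ψ t) x with hG
    set L : ℝ → UnitAddTorus d → ℝ := fun t x => FunctionSpaces.Torus.laplacian (ψ t) x with hL
    change (∫ t in Ioo 0 T, ∫ x, W t x * G t x) + ∫ x, θ₀ x * ψ 0 x = 0
    -- bounds on the test function
    obtain ⟨C₁, hC₁⟩ := exists_bound_of_continuous_uncurry hψ.continuous_uncurry_timeDeriv 0 T
    obtain ⟨C₂, hC₂⟩ := exists_bound_of_continuous_uncurry hψ.continuous_uncurry_gradient 0 T
    obtain ⟨C₃, hC₃⟩ := exists_bound_of_continuous_uncurry hψ.continuous_uncurry_laplacian 0 T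
    have hae : ∀ᵐ p ∂μ, p.1 ∈ Ioo 0 T :=
      (Measure.quasiMeasurePreserving_fst (μ := (volume : Measure ℝ).restrict (Ioo 0 T))
        (ν := (volume : Measure (UnitAddTorus d)))).ae (ae_restrict_mem measurableSet_Ioo)
    -- `G` is bounded a.e. and measurable, hence square integrable, on `(0,T) × T^d`
    set M : ℝ := C₁ + Cu * C₂ + |(0 : ℝ)| * C₃ with hM
    have hGbd : ∀ᵐ p ∂μ, ‖G p.1 p.2‖ ≤ M := by
      filter_upwards [hae, hCu] with p hp hpu
      have hp' : p.1 ∈ Icc 0 T := Ioo_subset_Icc_self hp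
      have h1 : ‖FunctionSpaces.Torus.timeDeriv ψ p.1 p.2‖ ≤ C₁ := hC₁ p.1 hp' p.2
      have h2 : ‖⟪u p.1 p.2, FunctionSpaces.Torus.gradient (ψ p.1) p.2⟫_ℝ‖ ≤ Cu * C₂ :=
        (norm_inner_le_norm _ _).trans (mul_le_mul hpu (hC₂ p.1 hp' p.2) (norm_nonneg _) hCu0)
      have h3 : ‖(0 : ℝ) * FunctionSpaces.Torus.laplacian (ψ p.1) p.2‖ ≤ |(0 : ℝ)| * C₃ := by
        rw [norm_mul, Real.norm_eq_abs]
        exact mul_le_mul_of_nonneg_left (hC₃ p.1 hp' p.2) (abs_nonneg _)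
      calc ‖G p.1 p.2‖ ≤ ‖FunctionSpaces.Torus.timeDeriv ψ p.1 p.2‖ +
            ‖⟪u p.1 p.2, FunctionSpaces.Torus.gradient (ψ p.1) p.2⟫_ℝ‖ +
            ‖(0 : ℝ) * FunctionSpaces.Torus.laplacian (ψ p.1) p.2‖ := norm_add₃_le
        _ ≤ M := add_le_add (add_le_add h1 h2) h3
    have hGm : AEStronglyMeasurable (uncurry G) μ := by
      change AEStronglyMeasurable (fun p : ℝ × UnitAddTorus d =>
        FunctionSpaces.Torus.timeDeriv ψ p.1 p.2 + ⟪u p.1 p.2, FunctionSpaces.Torus.gradient (ψ p.1) p.2⟫_ℝ +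
          0 * FunctionSpaces.Torus.laplacian (ψ p.1) p.2) μ
      refine ((?_ : AEStronglyMeasurable _ μ).add ?_).add ?_
      · exact hψ.continuous_uncurry_timeDeriv.aestronglyMeasurable
      · exact hum.inner hψ.continuous_uncurry_gradient.aestronglyMeasurable
      · exact (continuous_const.mul hψ.continuous_uncurry_laplacian).aestronglyMeasurable
    have hLm : AEStronglyMeasurable (uncurry L) μ := hψ.continuous_uncurry_laplacian.aestronglyMeasurable
    have hLbd : ∀ᵐ p ∂μ, ‖L p.1 p.2‖ ≤ C₃ := by
      filter_upwards [hae] with p hp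
      exact hC₃ p.1 (Ioo_subset_Icc_self hp) p.2
    have hG2 : ∫⁻ t in Ioo 0 T, ∫⁻ x, ‖G t x‖ₑ ^ 2 < ⊤ := by
      have h1 : ∫⁻ p, ‖uncurry G p‖ₑ ^ 2 ∂μ ≤ ∫⁻ _, ENNReal.ofReal M ^ 2 ∂μ := by
        refine lintegral_mono_ae ?_
        filter_upwards [hGbd] with p hp
        gcongr
        rw [← ofReal_norm]
        exact ENNReal.ofReal_le_ofReal hp
      rw [lintegral_prod _ (hGm.aemeasurable.enorm.pow_const 2)] at h1
      refine lt_of_le_of_lt h1 ?_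
      rw [lintegral_const]
      exact ENNReal.mul_lt_top (ENNReal.pow_lt_top ENNReal.ofReal_lt_top) (measure_lt_top _ _)
    have hGst : AEStronglyMeasurable (FunctionSpaces.Torus.stLift G) (volume.restrict (Ioo 0 T ×ˢ univ)) :=
      FunctionSpaces.Torus.aestronglyMeasurable_stLift_of_uncurry hGm
    -- (a) the weak convergence `∫∫ θ_{φ j} G → ∫∫ W G`
    have hA := hWlim G hGst hG2
    -- (b) the splitting of the `n`-th weak identity: `∫∫ θₙ G = -κₙ ∫∫ θₙ Δψ - ∫ θ₀ ψ(0)`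
    have hθG : ∀ n, Integrable (fun p : ℝ × UnitAddTorus d => θ n p.1 p.2 * G p.1 p.2) μ := fun n =>
      (hsol n).integrable_uncurry.mul_bdd hGm hGbd
    have hθL : ∀ n, Integrable (fun p : ℝ × UnitAddTorus d => θ n p.1 p.2 * L p.1 p.2) μ := fun n =>
      (hsol n).integrable_uncurry.mul_bdd hLm hLbd
    have hsplit : ∀ n (p : ℝ × UnitAddTorus d), θ n p.1 p.2 *
        (FunctionSpaces.Torus.timeDeriv ψ p.1 p.2 + ⟪u p.1 p.2, FunctionSpaces.Torus.gradient (ψ p.1) p.2⟫_ℝ +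
          κ n * FunctionSpaces.Torus.laplacian (ψ p.1) p.2) =
        θ n p.1 p.2 * G p.1 p.2 + κ n * (θ n p.1 p.2 * L p.1 p.2) := by
      intro n p
      simp only [hG, hL]
      ring
    have hident : ∀ n, (∫ t in Ioo 0 T, ∫ x, θ n t x * G t x) =
        -(κ n * ∫ p, θ n p.1 p.2 * L p.1 p.2 ∂μ) - ∫ x, θ₀ x * ψ 0 x := by
      intro n
      have h0 := (hsol n).integral_prod_weak_eq hψ
      have h1 : (∫ p, θ n p.1 p.2 *
          (FunctionSpaces.Torus.timeDeriv ψ p.1 p.2 + ⟪u p.1 p.2, FunctionSpaces.Torus.gradient (ψ p.1) p.2⟫_ℝ +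
            κ n * FunctionSpaces.Torus.laplacian (ψ p.1) p.2) ∂μ) =
          (∫ p, θ n p.1 p.2 * G p.1 p.2 ∂μ) + κ n * ∫ p, θ n p.1 p.2 * L p.1 p.2 ∂μ := by
        rw [← integral_const_mul, ← integral_add (hθG n) ((hθL n).const_mul _)]
        exact integral_congr_ae (Eventually.of_forall fun p => hsplit n p)
      have h2 : (∫ p, θ n p.1 p.2 * G p.1 p.2 ∂μ) = ∫ t in Ioo 0 T, ∫ x, θ n t x * G t x :=
        integral_prod _ (hθG n)
      rw [h1, h2] at h0
      linarith
    -- (c) the diffusion error `κₙ ∫∫ θₙ Δψ → 0`: `|∫∫ θₙ Δψ| ≤ C₃ (T + ∫|θ₀|²)` uniformly in `n`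
    set K : ℝ≥0∞ := μ univ + (C : ℝ≥0∞) * volume (Ioo (0 : ℝ) T) with hK
    have hKfin : K < ⊤ := ENNReal.add_lt_top.2
      ⟨measure_lt_top _ _, ENNReal.mul_lt_top ENNReal.coe_lt_top measure_Ioo_lt_top⟩
    have hL1 : ∀ n, ∫⁻ p, ‖θ n p.1 p.2‖ₑ ∂μ ≤ K := by
      intro n
      have h2 : ∫⁻ p, ‖uncurry (θ n) p‖ₑ ^ 2 ∂μ ≤ (C : ℝ≥0∞) * volume (Ioo (0 : ℝ) T) := by
        rw [lintegral_prod _ ((hsol n).aestronglyMeasurable_uncurry.aemeasurable.enorm.pow_const 2)]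
        calc ∫⁻ t in Ioo 0 T, ∫⁻ x, ‖uncurry (θ n) (t, x)‖ₑ ^ 2 ≤ ∫⁻ _ in Ioo (0 : ℝ) T, (C : ℝ≥0∞) :=
              lintegral_mono_ae (hbd n)
          _ = (C : ℝ≥0∞) * volume (Ioo (0 : ℝ) T) := by rw [lintegral_const, Measure.restrict_apply_univ]
      calc ∫⁻ p, ‖θ n p.1 p.2‖ₑ ∂μ ≤ ∫⁻ p, (1 + ‖θ n p.1 p.2‖ₑ ^ 2) ∂μ :=
            lintegral_mono fun p => ennreal_le_one_add_sq _
        _ = μ univ + ∫⁻ p, ‖θ n p.1 p.2‖ₑ ^ 2 ∂μ := by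
            rw [lintegral_add_left' aemeasurable_const, lintegral_const, one_mul]
        _ ≤ K := add_le_add le_rfl h2
    have hJbound : ∀ n, ‖∫ p, θ n p.1 p.2 * L p.1 p.2 ∂μ‖ ≤ C₃ * K.toReal := by
      intro n
      have h1 : ‖∫ p, θ n p.1 p.2 * L p.1 p.2 ∂μ‖ ≤ ∫ p, ‖θ n p.1 p.2 * L p.1 p.2‖ ∂μ :=
        norm_integral_le_integral_norm _
      refine h1.trans ?_
      have h2 : ∫ p, ‖θ n p.1 p.2 * L p.1 p.2‖ ∂μ ≤ ∫ p, C₃ * ‖θ n p.1 p.2‖ ∂μ := by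
        refine integral_mono_ae (hθL n).norm ((hsol n).integrable_uncurry.norm.const_mul C₃) ?_
        filter_upwards [hLbd] with p hp
        rw [norm_mul, mul_comm]
        exact mul_le_mul_of_nonneg_right hp (norm_nonneg _)
      refine h2.trans ?_
      rw [integral_const_mul]
      have hC₃0 : 0 ≤ C₃ := le_trans (norm_nonneg _) (hC₃ 0 (left_mem_Icc.2 hT.le) 0)
      refine mul_le_mul_of_nonneg_left ?_ hC₃0
      have h3 : ∫ a, ‖uncurry (θ n) a‖ ∂μ = (∫⁻ a, ‖uncurry (θ n) a‖ₑ ∂μ).toReal :=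
        integral_norm_eq_lintegral_enorm (hsol n).aestronglyMeasurable_uncurry
      calc ∫ a, ‖θ n a.1 a.2‖ ∂μ = ∫ a, ‖uncurry (θ n) a‖ ∂μ := rfl
        _ = (∫⁻ a, ‖uncurry (θ n) a‖ₑ ∂μ).toReal := h3
        _ ≤ K.toReal := ENNReal.toReal_mono hKfin.ne (hL1 n)
    have hJ : Tendsto (fun n => κ n * ∫ p, θ n p.1 p.2 * L p.1 p.2 ∂μ) atTop (𝓝 0) := by
      have h0 : Tendsto (fun n => κ n * (C₃ * K.toReal)) atTop (𝓝 0) := by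
        simpa using hκlim.mul_const (C₃ * K.toReal)
      refine squeeze_zero_norm (fun n => ?_) h0
      rw [norm_mul, Real.norm_of_nonneg (hκpos n).le]
      exact mul_le_mul_of_nonneg_left (hJbound n) (hκpos n).le
    -- (d) conclusion along the subsequence
    have hJφ : Tendsto (fun j => κ (φ j) * ∫ p, θ (φ j) p.1 p.2 * L p.1 p.2 ∂μ) atTop (𝓝 0) :=
      hJ.comp hφ.tendsto_atTop
    have hA' : Tendsto (fun j => ∫ t in Ioo 0 T, ∫ x, θ (φ j) t x * G t x) atTop
        (𝓝 (-(0 : ℝ) - ∫ x, θ₀ x * ψ 0 x)) :=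
      (hJφ.neg.sub_const _).congr fun j => (hident (φ j)).symm
    rw [tendsto_nhds_unique hA hA']
    ring

end VanishingViscosity

/-! ## §2 Transfer tools: a.e.-in-time modifications, a.e. versus everywhere for continuous functions -/

section Tools

omit [Fintype d] in
/-- Two functions continuous on `[0,T]` that agree for a.e. `t ∈ (0,T)` agree on `[0,T]`
(`T > 0`). [folklore] -/
private theorem eqOn_Icc_of_ae_restrict_Ioo {Y : Type*} [TopologicalSpace Y] [T2Space Y] {T : ℝ} (hT : 0 < T)
    {f g : ℝ → Y} (hf : ContinuousOn f (Icc 0 T)) (hg : ContinuousOn g (Icc 0 T))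
    (h : ∀ᵐ t ∂(volume.restrict (Ioo 0 T)), f t = g t) : EqOn f g (Icc 0 T) := by
  refine Measure.eqOn_Icc_of_ae_eq (μ := volume) hT.ne ?_ hf hg
  have e : (volume : Measure ℝ).restrict (Icc 0 T) = volume.restrict (Ioo 0 T) :=
    Measure.restrict_congr_set Ioo_ae_eq_Icc.symm
  rw [e]
  exact h

omit [Fintype d] in
/-- A function continuous on `[0,T]` which is `≤ M` for a.e. `t ∈ (0,T)` is `≤ M` on `[0,T]`
(`T > 0`). [folklore] -/
private theorem le_on_Icc_of_ae_restrict_Ioo {T : ℝ} (hT : 0 < T) {f : ℝ → ℝ} {M : ℝ}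
    (hf : ContinuousOn f (Icc 0 T)) (h : ∀ᵐ t ∂(volume.restrict (Ioo 0 T)), f t ≤ M) :
    ∀ t ∈ Icc 0 T, f t ≤ M := by
  have key := eqOn_Icc_of_ae_restrict_Ioo (Y := ℝ) hT (hf.sup continuousOn_const) continuousOn_const
    (f := fun t => max (f t) M) (g := fun _ => M) (by filter_upwards [h] with t ht; exact max_eq_right ht)
  intro t ht
  have := key ht
  simp only at this
  exact (le_max_left _ _).trans this.le

namespace IsWeakScalarTransportOn

variable {T κ : ℝ} {u : ℝ → UnitAddTorus d → EuclideanSpace ℝ d} {θ₀ : UnitAddTorus d → ℝ}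
  {θ θ' : ℝ → UnitAddTorus d → ℝ}

/-- **Modification on null sets of times**: a space–time measurable field `θ'` whose slices agree
a.e. with those of a weak solution `θ` for a.e. `t ∈ (0,T)` is a weak solution with the same
drift and datum (every clause of the weak class is an iterated integral over `(0,T)` or an a.e.
statement in `t`). [cite: DiPernaLions1989, §II.1] -/
theorem congr_ae_slice (h : IsWeakScalarTransportOn T κ u θ₀ θ)
    (hm : AEStronglyMeasurable (FunctionSpaces.Torus.stLift θ') (volume.restrict (Ioo 0 T ×ˢ univ)))
    (hae : ∀ᵐ t ∂(volume.restrict (Ioo 0 T)), θ' t =ᵐ[volume] θ t) :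
    IsWeakScalarTransportOn T κ u θ₀ θ' := by
  obtain ⟨C, hC⟩ := h.ae_lintegral_sq_le
  refine ⟨hm, h.aestronglyMeasurable_velocity, ⟨C, ?_⟩, h.lintegral_velocity_lt_top, ?_,
    h.ae_isWeaklyDivFree, fun ψ hψ => ?_⟩
  · filter_upwards [hC, hae] with t ht hte
    have e : ∫⁻ x, ‖θ' t x‖ₑ ^ 2 = ∫⁻ x, ‖θ t x‖ₑ ^ 2 :=
      lintegral_congr_ae (hte.mono fun x hx => by simp only [hx])
    rw [e]
    exact ht
  · have e : ∫⁻ t in Ioo 0 T, ∫⁻ x, ‖u t x‖ₑ * ‖θ' t x‖ₑ = ∫⁻ t in Ioo 0 T, ∫⁻ x, ‖u t x‖ₑ * ‖θ t x‖ₑ := by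
      refine lintegral_congr_ae ?_
      filter_upwards [hae] with t hte
      exact lintegral_congr_ae (hte.mono fun x hx => by simp only [hx])
    rw [e]
    exact h.lintegral_mul_lt_top
  · have e : (∫ t in Ioo 0 T, ∫ x, θ' t x *
        (FunctionSpaces.Torus.timeDeriv ψ t x + ⟪u t x, FunctionSpaces.Torus.gradient (ψ t) x⟫_ℝ +
          κ * FunctionSpaces.Torus.laplacian (ψ t) x)) =
        ∫ t in Ioo 0 T, ∫ x, θ t x *
          (FunctionSpaces.Torus.timeDeriv ψ t x + ⟪u t x, FunctionSpaces.Torus.gradient (ψ t) x⟫_ℝ +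
            κ * FunctionSpaces.Torus.laplacian (ψ t) x) := by
      refine integral_congr_ae ?_
      filter_upwards [hae] with t hte
      exact integral_congr_ae (hte.mono fun x hx => by simp only [hx])
    rw [e]
    exact h.weak_eq ψ hψ

end IsWeakScalarTransportOn

end Tools

/-! ## §3 Fields with prescribed Fourier coefficients: `L²` bound and weak continuity in time -/

section CoeffTools

open Literature.Analysis.FunctionSpaces.Torus Literature.Analysis.FunctionSpaces

/-- **`L²` bound from a bound on the finite Fourier sums** (Parseval): if `𝓕f = a` and
`∑_{k∈F} ‖a k‖² ≤ E` for every finite `F ⊆ ℤ^d`, then `∫ f² ≤ E`. [folklore] -/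
private theorem integral_sq_le_of_forall_sum_sq_le {f : UnitAddTorus d → ℝ} (hf : MemLp f 2 volume)
    {a : (d → ℤ) → ℂ} (ha : ∀ k, mFourierCoeff (fun x => ((f x : ℝ) : ℂ)) k = a k) {E : ℝ}
    (hE : ∀ F : Finset (d → ℤ), ∑ k ∈ F, ‖a k‖ ^ 2 ≤ E) : ∫ x, f x ^ 2 ≤ E := by
  have hP := hasSum_sq_norm_mFourierCoeff_ofReal hf
  simp_rw [ha] at hP
  rw [← hP.tsum_eq]
  exact hP.summable.tsum_le_of_sum_le hE

/-- Two real integrable functions on `T^d` with the same Fourier coefficients agree a.e.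
(uniqueness of Fourier coefficients, Grafakos 2014, Prop. 3.2.4, through the complexification).
[cite: Grafakos2014, Prop. 3.2.4] -/
theorem ae_eq_of_forall_mFourierCoeff_ofReal_eq {f g : UnitAddTorus d → ℝ} (hf : Integrable f volume)
    (hg : Integrable g volume)
    (h : ∀ k, mFourierCoeff (fun x => ((f x : ℝ) : ℂ)) k = mFourierCoeff (fun x => ((g x : ℝ) : ℂ)) k) :
    f =ᵐ[volume] g := by
  filter_upwards [ae_eq_of_forall_mFourierCoeff_eq hf.ofReal hg.ofReal h] with x hx
  exact_mod_cast hx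

variable [DecidableEq d]

/-- Pairings with Fourier truncations are continuous in time on a set of times where the
(finitely many) prescribed coefficients are. [folklore] -/
private theorem continuousOn_integral_mul_scalarTruncate_of_coeff {S : Set ℝ} {c : ℝ → (d → ℤ) → ℂ}
    {w : ℝ → UnitAddTorus d → ℝ} (hcont : ∀ k, ContinuousOn (fun t => c t k) S)
    (hmem : ∀ t ∈ S, MemLp (w t) 2 volume)
    (hcoeff : ∀ t ∈ S, ∀ k, mFourierCoeff (fun x => ((w t x : ℝ) : ℂ)) k = c t k)
    (g : UnitAddTorus d → ℝ) (M : ℕ) :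
    ContinuousOn (fun t => ∫ x, w t x * scalarTruncate M g x) S := by
  have hF : ContinuousOn (fun t => ∑ k ∈ freqBall M,
      (mFourierCoeff (fun x => ((g x : ℝ) : ℂ)) k * c t (-k)).re) S := by
    refine continuousOn_finsetSum _ fun k _ => ?_
    exact Complex.continuous_re.comp_continuousOn (continuousOn_const.mul (hcont (-k)))
  refine hF.congr fun t ht => ?_
  show ∫ x, w t x * scalarTruncate M g x = _
  rw [scalarTruncate, integral_mul_reTrigPoly ((hmem t ht).integrable one_le_two)]
  refine Finset.sum_congr rfl fun k _ => ?_
  rw [hcoeff t ht]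

/-- **Weak continuity in time from continuous Fourier coefficients and a uniform `L²` bound**:
if `𝓕(w(t)) = c(t)` on a set of times `S` where every `c(·) k` is continuous and `∫ w(t)² ≤ E`,
then `t ↦ ∫ w(t) g` is continuous on `S` for every `g ∈ L²(T^d)` (continuous against
trigonometric polynomials; uniform approximation through the uniform `L²` bound and `P_M g → g`
in `L²` — the argument of `IsGalerkinLimit.continuousOn_integral_mul`, De Lellis–Székelyhidi 2010,
Lemma 7.1 / Appendix A). [cite: DeLellisSzekelyhidi2010, Lemma 7.1] -/
theorem continuousOn_integral_mul_of_coeff {S : Set ℝ} {c : ℝ → (d → ℤ) → ℂ}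
    {w : ℝ → UnitAddTorus d → ℝ} (hcont : ∀ k, ContinuousOn (fun t => c t k) S)
    (hmem : ∀ t ∈ S, MemLp (w t) 2 volume)
    (hcoeff : ∀ t ∈ S, ∀ k, mFourierCoeff (fun x => ((w t x : ℝ) : ℂ)) k = c t k)
    {E : ℝ} (hE : ∀ t ∈ S, ∫ x, w t x ^ 2 ≤ E)
    {g : UnitAddTorus d → ℝ} (hg : MemLp g 2 volume) :
    ContinuousOn (fun t => ∫ x, w t x * g x) S := by
  rcases S.eq_empty_or_nonempty with rfl | ⟨t₀, ht₀⟩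
  · exact continuousOn_empty _
  have hE0 : 0 ≤ E := (integral_nonneg fun x => sq_nonneg _).trans (hE t₀ ht₀)
  have hunif : TendstoUniformlyOn (fun M t => ∫ x, w t x * scalarTruncate M g x) (fun t => ∫ x, w t x * g x)
      atTop S := by
    refine Metric.tendstoUniformlyOn_iff.2 fun ε hε => ?_
    set δ : ℝ := ε / (E + 1) with hδ
    have hδ0 : 0 < δ := by positivity
    have hη := tendsto_integral_sq_sub_scalarTruncate hg
    have hev : ∀ᶠ M in atTop, ∫ x, (g x - scalarTruncate M g x) ^ 2 < δ * ε :=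
      (tendsto_order.1 hη).2 _ (by positivity)
    filter_upwards [hev] with M hM t ht
    have hgM : MemLp (fun x => g x - scalarTruncate M g x) 2 volume := hg.sub (memLp_scalarTruncate M g 2)
    have hsplit : (∫ x, w t x * g x) - ∫ x, w t x * scalarTruncate M g x = ∫ x, w t x * (g x - scalarTruncate M g x) := by
      have i1 : Integrable (fun x => w t x * g x) volume := (hmem t ht).integrable_mul hg
      have i2 : Integrable (fun x => w t x * scalarTruncate M g x) volume :=
        (hmem t ht).integrable_mul (memLp_scalarTruncate M g 2)
      rw [← integral_sub i1 i2]
      refine integral_congr_ae (ae_of_all _ fun x => ?_)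
      ring
    rw [Real.dist_eq, hsplit]
    have hb1 := abs_integral_mul_le_weighted (hmem t ht) hgM hδ0
    have hw2 : ∫ x, w t x ^ 2 ≤ E := hE t ht
    have h1 : δ * ∫ x, w t x ^ 2 ≤ δ * E := mul_le_mul_of_nonneg_left hw2 hδ0.le
    have h2 : δ⁻¹ * ∫ x, (g x - scalarTruncate M g x) ^ 2 < δ⁻¹ * (δ * ε) :=
      mul_lt_mul_of_pos_left hM (inv_pos.2 hδ0)
    have h3 : δ⁻¹ * (δ * ε) = ε := by field_simp
    rw [h3] at h2
    have h4 : δ * E < ε := by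
      rw [hδ, div_mul_eq_mul_div, div_lt_iff₀ (by positivity)]
      nlinarith
    calc |∫ x, w t x * (g x - scalarTruncate M g x)|
        ≤ (δ * (∫ x, w t x ^ 2) + δ⁻¹ * ∫ x, (g x - scalarTruncate M g x) ^ 2) / 2 := hb1
      _ < (ε + ε) / 2 := by linarith
      _ = ε := by ring
  exact hunif.continuousOn
    (Eventually.of_forall fun M => continuousOn_integral_mul_scalarTruncate_of_coeff hcont hmem hcoeff g M).frequently

end CoeffTools

/-! ## §4 The continuous coefficient family of a weak solution and its Riesz–Fischer representative -/

section Representative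

open Literature.Analysis.FunctionSpaces.Torus Literature.Analysis.FunctionSpaces

namespace IsWeakScalarTransportOn

variable {T κ : ℝ} {u : ℝ → UnitAddTorus d → EuclideanSpace ℝ d} {θ₀ : UnitAddTorus d → ℝ}
  {θ : ℝ → UnitAddTorus d → ℝ}

/-- The absolutely continuous representative `t ↦ ∫ θ₀ g + ∫_{(0,t]} ∫ θ(τ) (⟪u(τ), ∇g⟫ + κΔg) dτ`
of the pairing of a weak solution with a steady smooth field (`ae_integral_mul_eq`) is continuous
on `[0,T]` (the primitive of a function integrable on `(0,T)`). [folklore] -/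
private theorem continuousOn_pairingPrimitive (h : IsWeakScalarTransportOn T κ u θ₀ θ)
    {g : UnitAddTorus d → ℝ} (hg : IsSmooth g) :
    ContinuousOn (fun t => (∫ x, θ₀ x * g x) +
      ∫ τ in Ioc 0 t, ∫ x, θ τ x * (⟪u τ x, gradient g x⟫_ℝ + κ * laplacian g x)) (Icc 0 T) := by
  have hF0 : IntegrableOn (fun τ => ∫ x, θ τ x * (⟪u τ x, gradient g x⟫_ℝ + κ * laplacian g x))
      (Ioo 0 T) volume :=
    (h.integrable_mul_steadyFlux hg).integral_prod_left
  have hF : IntegrableOn (fun τ => ∫ x, θ τ x * (⟪u τ x, gradient g x⟫_ℝ + κ * laplacian g x))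
      (Icc 0 T) volume :=
    hF0.congr_set_ae Ioo_ae_eq_Icc.symm
  exact continuousOn_const.add (intervalIntegral.continuousOn_primitive hF)

/-- **The continuous Fourier coefficient family of a weak solution.** For a weak solution `θ` of
`∂ₜθ + u·∇θ = κΔθ` on `T^d × [0,T)` with datum `θ₀ ∈ L²` and `∫ |θ(t)|² ≤ ∫ |θ₀|²` for a.e. `t`,
there is a family `c : [0,∞) × ℤ^d → ℂ` (extended constantly beyond `T`) with every `c(·) k`
continuous, `∑_{k∈F} ‖c(t) k‖² ≤ ∫ θ₀²` and `c(t)(-k) = conj (c(t) k)` for EVERY `t ≥ 0`,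
`c(0) = 𝓕θ₀`, and `c(t) = 𝓕(θ(t))` for a.e. `t ∈ (0,T)`. Construction: the real and imaginary
parts of `c(t) k` are the absolutely continuous representatives of the pairings of `θ` with the
cosine and sine modes (`ae_integral_mul_eq`, DiPerna–Lions 1989, (14)); the finite Bessel sums and
the reality condition, continuous in `t` and valid for a.e. `t`, hold for every `t`
(De Lellis–Székelyhidi 2010, Lemma 7.1 / Appendix A: the weakly continuous representative).
[cite: DeLellisSzekelyhidi2010, Lemma 7.1] -/
theorem exists_continuous_coeff (hT : 0 < T) (h : IsWeakScalarTransportOn T κ u θ₀ θ)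
    (hθ₀ : MemLp θ₀ 2 volume)
    (hbd : ∀ᵐ t ∂(volume.restrict (Ioo 0 T)), ∫⁻ x, ‖θ t x‖ₑ ^ 2 ≤ ∫⁻ x, ‖θ₀ x‖ₑ ^ 2) :
    ∃ c : ℝ → (d → ℤ) → ℂ,
      (∀ k, ContinuousOn (fun t => c t k) (Ici 0)) ∧
      (∀ t, 0 ≤ t → ∀ F : Finset (d → ℤ), ∑ k ∈ F, ‖c t k‖ ^ 2 ≤ ∫ x, θ₀ x ^ 2) ∧
      (∀ t, 0 ≤ t → ∀ k, c t (-k) = conj (c t k)) ∧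
      (∀ k, c 0 k = mFourierCoeff (fun x => ((θ₀ x : ℝ) : ℂ)) k) ∧
      (∀ᵐ t ∂(volume.restrict (Ioo 0 T)), ∀ k, c t k = mFourierCoeff (fun x => ((θ t x : ℝ) : ℂ)) k) := by
  -- the primitive predicted by the equation for the pairing with a steady smooth field
  set P : (UnitAddTorus d → ℝ) → ℝ → ℝ := fun g t => (∫ x, θ₀ x * g x) +
      ∫ τ in Ioc 0 t, ∫ x, θ τ x * (⟪u τ x, gradient g x⟫_ℝ + κ * laplacian g x) with hP
  clear_value P
  have hPc : ∀ {g : UnitAddTorus d → ℝ}, IsSmooth g → ContinuousOn (P g) (Icc 0 T) := fun hg => by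
    rw [hP]
    exact h.continuousOn_pairingPrimitive hg
  have hPae : ∀ {g : UnitAddTorus d → ℝ}, IsSmooth g →
      ∀ᵐ t ∂(volume.restrict (Ioo 0 T)), ∫ x, θ t x * g x = P g t := fun hg => by
    rw [hP]
    exact h.ae_integral_mul_eq hg
  have hP0 : ∀ g : UnitAddTorus d → ℝ, P g 0 = ∫ x, θ₀ x * g x := fun g => by
    rw [hP]
    simp only [Ioc_self, Measure.restrict_empty, integral_zero_measure, add_zero]
  -- the family on `[0,T]`: real part from the cosine mode, imaginary part from the sine mode
  set c₀ : ℝ → (d → ℤ) → ℂ := fun t k => ((P (reTrigPoly {-k} fun _ => (1 : ℂ)) t : ℝ) : ℂ) +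
      ((P (reTrigPoly {-k} fun _ => -Complex.I) t : ℝ) : ℂ) * Complex.I with hc₀
  clear_value c₀
  have hc₀c : ∀ k, ContinuousOn (fun t => c₀ t k) (Icc 0 T) := fun k => by
    simp only [hc₀]
    exact (Complex.continuous_ofReal.comp_continuousOn (hPc (isSmooth_reTrigPoly _ _))).add
      ((Complex.continuous_ofReal.comp_continuousOn (hPc (isSmooth_reTrigPoly _ _))).mul
        continuousOn_const)
  -- identification with the Fourier coefficients of the slices, for a.e. `t ∈ (0,T)`
  have hid : ∀ᵐ t ∂(volume.restrict (Ioo 0 T)), ∀ k,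
      c₀ t k = mFourierCoeff (fun x => ((θ t x : ℝ) : ℂ)) k := by
    have hA : ∀ᵐ t ∂(volume.restrict (Ioo 0 T)), ∀ k : d → ℤ,
        ∫ x, θ t x * reTrigPoly {-k} (fun _ => (1 : ℂ)) x = P (reTrigPoly {-k} fun _ => (1 : ℂ)) t :=
      ae_all_iff.2 fun k => hPae (isSmooth_reTrigPoly _ _)
    have hB : ∀ᵐ t ∂(volume.restrict (Ioo 0 T)), ∀ k : d → ℤ,
        ∫ x, θ t x * reTrigPoly {-k} (fun _ => -Complex.I) x = P (reTrigPoly {-k} fun _ => -Complex.I) t :=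
      ae_all_iff.2 fun k => hPae (isSmooth_reTrigPoly _ _)
    filter_upwards [hA, hB, h.ae_memLp_two] with t htA htB htm k
    have hI : Integrable (θ t) volume := htm.integrable one_le_two
    simp only [hc₀]
    rw [← htA k, ← htB k, ← re_mFourierCoeff_ofReal hI k, ← im_mFourierCoeff_ofReal hI k]
    exact Complex.re_add_im _
  -- the finite Bessel sums, for every `t ∈ [0,T]`
  have hsum : ∀ t ∈ Icc 0 T, ∀ F : Finset (d → ℤ), ∑ k ∈ F, ‖c₀ t k‖ ^ 2 ≤ ∫ x, θ₀ x ^ 2 := by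
    intro t ht F
    refine le_on_Icc_of_ae_restrict_Ioo hT (f := fun t => ∑ k ∈ F, ‖c₀ t k‖ ^ 2)
      (continuousOn_finsetSum _ fun k _ => ((hc₀c k).norm).pow 2) ?_ t ht
    filter_upwards [hid, h.ae_memLp_two, hbd] with s hs hsm hsb
    have e : ∑ k ∈ F, ‖c₀ s k‖ ^ 2 = ∑ k ∈ F, ‖mFourierCoeff (fun x => ((θ s x : ℝ) : ℂ)) k‖ ^ 2 :=
      Finset.sum_congr rfl fun k _ => by rw [hs k]
    show ∑ k ∈ F, ‖c₀ s k‖ ^ 2 ≤ _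
    rw [e]
    have h1 : ∑ k ∈ F, ‖mFourierCoeff (fun x => ((θ s x : ℝ) : ℂ)) k‖ ^ 2 ≤ ∫ x, θ s x ^ 2 :=
      sum_le_hasSum F (fun k _ => sq_nonneg _) (hasSum_sq_norm_mFourierCoeff_ofReal hsm)
    have h2 : ∫ x, θ s x ^ 2 ≤ ∫ x, θ₀ x ^ 2 := by
      rw [lintegral_enorm_sq_eq_ofReal_sq hsm, lintegral_enorm_sq_eq_ofReal_sq hθ₀] at hsb
      exact (ENNReal.ofReal_le_ofReal_iff (integral_nonneg fun x => sq_nonneg _)).1 hsb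
    exact h1.trans h2
  -- the reality condition, for every `t ∈ [0,T]`
  have hsym : ∀ t ∈ Icc 0 T, ∀ k, c₀ t (-k) = conj (c₀ t k) := by
    intro t ht k
    refine eqOn_Icc_of_ae_restrict_Ioo (Y := ℂ) hT (f := fun t => c₀ t (-k))
      (g := fun t => conj (c₀ t k)) (hc₀c (-k))
      (Complex.continuous_conj.comp_continuousOn (hc₀c k)) ?_ ht
    filter_upwards [hid] with s hs
    rw [hs (-k), hs k]
    exact isConjSymmScalar_mFourierCoeff (θ s) k
  -- the value at `t = 0`
  have h0 : ∀ k, c₀ 0 k = mFourierCoeff (fun x => ((θ₀ x : ℝ) : ℂ)) k := by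
    intro k
    have hI₀ : Integrable θ₀ volume := hθ₀.integrable one_le_two
    simp only [hc₀]
    rw [hP0, hP0, ← re_mFourierCoeff_ofReal hI₀ k, ← im_mFourierCoeff_ofReal hI₀ k]
    exact Complex.re_add_im _
  -- the family clamped to `[0,T]`
  have hcl : ∀ t : ℝ, (Set.projIcc 0 T hT.le t : ℝ) ∈ Icc 0 T := fun t => (Set.projIcc 0 T hT.le t).2
  have hcl_eq : ∀ t ∈ Icc 0 T, (Set.projIcc 0 T hT.le t : ℝ) = t := fun t ht => by
    rw [Set.projIcc_of_mem hT.le ht]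
  refine ⟨fun t k => c₀ (Set.projIcc 0 T hT.le t : ℝ) k, fun k => ?_, fun t _ F => hsum _ (hcl t) F,
    fun t _ k => hsym _ (hcl t) k, fun k => ?_, ?_⟩
  · exact (hc₀c k).comp (continuous_subtype_val.comp continuous_projIcc).continuousOn fun t _ => hcl t
  · show c₀ (Set.projIcc 0 T hT.le 0 : ℝ) k = _
    rw [hcl_eq 0 (left_mem_Icc.2 hT.le)]
    exact h0 k
  · filter_upwards [hid, ae_restrict_mem measurableSet_Ioo] with t ht htI k
    show c₀ (Set.projIcc 0 T hT.le t : ℝ) k = _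
    rw [hcl_eq t (Ioo_subset_Icc_self htI)]
    exact ht k

end IsWeakScalarTransportOn

variable [DecidableEq d] [Nonempty d] in
/-- **A real scalar field with prescribed Fourier coefficients for every `t ≥ 0`** (positive
dimension): for a coefficient family `c` with every `c(·) k` continuous on `[0,∞)`, finite sums
`∑_{k∈F} ‖c(t) k‖² ≤ E` and the reality condition for every `t ≥ 0`, there is a real field `w`,
jointly measurable on `(0,∞) × T^d` through its space–time lift, with `w(t) ∈ L²` and
`𝓕(w(t)) = c(t)` for EVERY `t ≥ 0` (the parametrised Riesz–Fischer theorem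
`exists_realField_forall_mFourierCoeff_eq` applied to the coefficients embedded along one
coordinate of `ℂ^d`, as in `Torus.exists_limitField`; Robinson–Rodrigo–Sadowski 2016, proof of
Thm. 4.11). [cite: RobinsonRodrigoSadowski2016, Thm. 4.11] -/
theorem exists_realScalarField_forall_mFourierCoeff_eq {c : ℝ → (d → ℤ) → ℂ} {E : ℝ}
    (hcont : ∀ k, ContinuousOn (fun t => c t k) (Ici 0))
    (hsum : ∀ t, 0 ≤ t → ∀ F : Finset (d → ℤ), ∑ k ∈ F, ‖c t k‖ ^ 2 ≤ E)
    (hsymm : ∀ t, 0 ≤ t → ∀ k, c t (-k) = conj (c t k)) :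
    ∃ w : ℝ → UnitAddTorus d → ℝ,
      AEStronglyMeasurable (stLift w) (volume.restrict (Ioi 0 ×ˢ univ)) ∧
      ∀ t, 0 ≤ t → MemLp (w t) 2 volume ∧ ∀ k, mFourierCoeff (fun x => ((w t x : ℝ) : ℂ)) k = c t k := by
  have hmeas : ∀ k, AEStronglyMeasurable (fun t => embedCoeff c t k) (volume.restrict (Ioi 0)) := by
    intro k
    have hc : ContinuousOn (fun t => embedCoeff c t k) (Ioi 0) :=
      ((hcont k).mono Ioi_subset_Ici_self).smul continuousOn_const
    exact hc.aestronglyMeasurable measurableSet_Ioi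
  have hbound : ∀ T : ℝ, ∃ K : ℝ≥0∞, K ≠ ⊤ ∧ ∀ t ∈ Icc 0 T, ∑' k, ‖embedCoeff c t k‖ₑ ^ 2 ≤ K := by
    intro T
    refine ⟨ENNReal.ofReal E, ENNReal.ofReal_ne_top, fun t ht => ?_⟩
    refine ENNReal.summable.tsum_le_of_sum_le fun F => ?_
    have h1 : ∑ k ∈ F, ‖embedCoeff c t k‖ₑ ^ 2 = ENNReal.ofReal (∑ k ∈ F, ‖c t k‖ ^ 2) := by
      rw [ENNReal.ofReal_sum_of_nonneg fun k _ => sq_nonneg _]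
      refine Finset.sum_congr rfl fun k _ => ?_
      rw [← ofReal_norm, norm_embedCoeff, ENNReal.ofReal_pow (norm_nonneg _)]
    rw [h1]
    exact ENNReal.ofReal_le_ofReal (hsum t ht.1 F)
  obtain ⟨v, hvm, hv⟩ := exists_realField_forall_mFourierCoeff_eq hmeas hbound
    fun t ht => isConjSymm_embedCoeff (hsymm t ht)
  set i₀ : d := Classical.arbitrary d with hi₀
  refine ⟨fun t x => v t x i₀, ?_, fun t ht => ⟨?_, fun k => ?_⟩⟩
  · exact (EuclideanSpace.proj i₀ : EuclideanSpace ℝ d →L[ℝ] ℝ).continuous.comp_aestronglyMeasurable hvm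
  · exact (EuclideanSpace.proj i₀ : EuclideanSpace ℝ d →L[ℝ] ℝ).comp_memLp' (hv t ht).1
  · have h := congrArg (fun z : EuclideanSpace ℂ d => z i₀) ((hv t ht).2 k)
    have hint : Integrable (EuclideanSpace.complexify ∘ v t) volume :=
      EuclideanSpace.complexify.toContinuousLinearMap.integrable_comp ((hv t ht).1.integrable one_le_two)
    simp only [mFourierCoeff_apply_euclidean hint, Function.comp_apply, EuclideanSpace.complexify_apply,
      embedCoeff, PiLp.smul_apply, smul_eq_mul] at h
    simpa [hi₀] using h

end Representative

/-! ## §5 Assembly -/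

section Assembly

open Literature.Analysis.FunctionSpaces.Torus Literature.Analysis.FunctionSpaces

/-- **Bounded measurable velocity, positive dimension**: the conclusion of
`BardosTitiWiedemann2012_transportExistence` for `d ≠ ∅` — the vanishing-viscosity weak solution
(§1), its continuous coefficient family and Riesz–Fischer representative (§4), with the slice
`t = 0` replaced by `w₀` (immaterial for the weak formulation and for the pairings, since the
representative at `t = 0` equals `w₀` a.e.). [cite: BardosTitiWiedemann2012, proof of Cor. 2] -/
theorem transportExistence_of_memLp_top [DecidableEq d] [Nonempty d] {T : ℝ} (hT : 0 < T)
    {b : ℝ → UnitAddTorus d → EuclideanSpace ℝ d}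
    (hb : MemLp (stLift b) ∞ (volume.restrict (Ioo 0 T ×ˢ univ)))
    (hdiv : ∀ᵐ t ∂(volume.restrict (Ioo 0 T)), FunctionSpaces.Torus.IsWeaklyDivFree (b t))
    {w₀ : UnitAddTorus d → ℝ} (hw₀ : MemLp w₀ 2 volume) :
    ∃ w : ℝ → UnitAddTorus d → ℝ,
      IsWeakScalarTransportOn T 0 b w₀ w ∧ (∀ t ∈ Icc 0 T, MemLp (w t) 2 volume) ∧
      (∀ t ∈ Icc 0 T, ∫⁻ x, ‖w t x‖ₑ ^ 2 ≤ ∫⁻ x, ‖w₀ x‖ₑ ^ 2) ∧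
      (∀ g : UnitAddTorus d → ℝ, MemLp g 2 volume → ContinuousOn (fun t => ∫ x, w t x * g x) (Icc 0 T)) ∧
      w 0 = w₀ := by
  obtain ⟨W, hW, hbd⟩ := exists_isWeakScalarTransportOn_zero_of_memLp_top hT hw₀ hb hdiv
  obtain ⟨c, hcont, hsum, hsymm, hc0, hid⟩ := hW.exists_continuous_coeff hT hw₀ hbd
  obtain ⟨w, hwm, hw⟩ := exists_realScalarField_forall_mFourierCoeff_eq hcont hsum hsymm
  have hI₀ : Integrable w₀ volume := hw₀.integrable one_le_two
  -- the slices of the representative: `w t = W t` a.e. for a.e. `t ∈ (0,T)`, and `w 0 = w₀` a.e.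
  have hae : ∀ᵐ t ∂(volume.restrict (Ioo 0 T)), w t =ᵐ[volume] W t := by
    filter_upwards [hid, hW.ae_memLp_two, ae_restrict_mem measurableSet_Ioo] with t ht htm htI
    exact ae_eq_of_forall_mFourierCoeff_ofReal_eq ((hw t htI.1.le).1.integrable one_le_two)
      (htm.integrable one_le_two) fun k => by rw [(hw t htI.1.le).2 k, ht k]
  have hae0 : w 0 =ᵐ[volume] w₀ :=
    ae_eq_of_forall_mFourierCoeff_ofReal_eq ((hw 0 le_rfl).1.integrable one_le_two) hI₀
      fun k => by rw [(hw 0 le_rfl).2 k, hc0 k]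
  have hsq : ∀ t, 0 ≤ t → ∫ x, w t x ^ 2 ≤ ∫ x, w₀ x ^ 2 := fun t ht =>
    integral_sq_le_of_forall_sum_sq_le (hw t ht).1 (hw t ht).2 (hsum t ht)
  -- the representative with the slice `t = 0` replaced by `w₀`
  set wr : ℝ → UnitAddTorus d → ℝ := fun t => if t = 0 then w₀ else w t with hwr
  have hwr0 : wr 0 = w₀ := by simp [hwr]
  have hwrt : ∀ {t : ℝ}, t ≠ 0 → wr t = w t := fun ht => by simp [hwr, ht]
  have hpair : ∀ (g : UnitAddTorus d → ℝ) (t : ℝ), ∫ x, wr t x * g x = ∫ x, w t x * g x := by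
    intro g t
    by_cases ht : t = 0
    · subst ht
      rw [hwr0]
      refine integral_congr_ae (hae0.mono fun x hx => ?_) |>.symm
      show w 0 x * g x = w₀ x * g x
      rw [hx]
    · rw [hwrt ht]
  refine ⟨wr, ?_, ?_, ?_, ?_, hwr0⟩
  · -- a modification of `W` on a null set of times
    refine hW.congr_ae_slice ?_ ?_
    · have h1 : AEStronglyMeasurable (stLift w) (volume.restrict (Ioo 0 T ×ˢ univ)) :=
        hwm.mono_set (Set.prod_mono Ioo_subset_Ioi_self subset_rfl)
      refine h1.congr ?_
      filter_upwards [ae_restrict_mem (measurableSet_Ioo.prod MeasurableSet.univ)] with p hp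
      simp only [stLift]
      rw [hwrt (Set.mem_prod.1 hp).1.1.ne']
    · filter_upwards [hae, ae_restrict_mem measurableSet_Ioo] with t ht htI
      rw [hwrt htI.1.ne']
      exact ht
  · intro t ht
    by_cases h0 : t = 0
    · subst h0
      rw [hwr0]
      exact hw₀
    · rw [hwrt h0]
      exact (hw t ht.1).1
  · intro t ht
    by_cases h0 : t = 0
    · subst h0
      rw [hwr0]
    · rw [hwrt h0, lintegral_enorm_sq_eq_ofReal_sq (hw t ht.1).1, lintegral_enorm_sq_eq_ofReal_sq hw₀]
      exact ENNReal.ofReal_le_ofReal (hsq t ht.1)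
  · intro g hg
    have hc : ContinuousOn (fun t => ∫ x, w t x * g x) (Icc 0 T) :=
      continuousOn_integral_mul_of_coeff (S := Icc 0 T) (fun k => (hcont k).mono Icc_subset_Ici_self)
        (fun t ht => (hw t ht.1).1) (fun t ht => (hw t ht.1).2) (fun t ht => hsq t ht.1) hg
    exact hc.congr fun t _ => hpair g t

/-- **The degenerate case `d = ∅`**: `T^d` is a point, the velocity pairing vanishes, the mean —
hence the function — is conserved for a.e. `t` (`ae_integral_mul_eq` with `g = 1`), and the
field constant in time equal to `w₀` does it. [folklore] -/
private theorem transportExistence_of_isEmpty [IsEmpty d] {T : ℝ} (hT : 0 < T)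
    {b : ℝ → UnitAddTorus d → EuclideanSpace ℝ d}
    (hb : MemLp (stLift b) ∞ (volume.restrict (Ioo 0 T ×ˢ univ)))
    (hdiv : ∀ᵐ t ∂(volume.restrict (Ioo 0 T)), FunctionSpaces.Torus.IsWeaklyDivFree (b t))
    {w₀ : UnitAddTorus d → ℝ} (hw₀ : MemLp w₀ 2 volume) :
    ∃ w : ℝ → UnitAddTorus d → ℝ,
      IsWeakScalarTransportOn T 0 b w₀ w ∧ (∀ t ∈ Icc 0 T, MemLp (w t) 2 volume) ∧
      (∀ t ∈ Icc 0 T, ∫⁻ x, ‖w t x‖ₑ ^ 2 ≤ ∫⁻ x, ‖w₀ x‖ₑ ^ 2) ∧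
      (∀ g : UnitAddTorus d → ℝ, MemLp g 2 volume → ContinuousOn (fun t => ∫ x, w t x * g x) (Icc 0 T)) ∧
      w 0 = w₀ := by
  obtain ⟨W, hW, -⟩ := exists_isWeakScalarTransportOn_zero_of_memLp_top hT hw₀ hb hdiv
  -- on the one-point space a function is its value at the point, and integrals are evaluations
  have x₀ : UnitAddTorus d := fun i => isEmptyElim i
  have hpt : ∀ f : UnitAddTorus d → ℝ, f = fun _ => f x₀ := fun f =>
    funext fun y => congrArg f (Subsingleton.elim y x₀)
  have hint : ∀ f : UnitAddTorus d → ℝ, ∫ x, f x = f x₀ := fun f => by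
    rw [hpt f]
    simp
  have hvec : ∀ v : EuclideanSpace ℝ d, v = 0 := fun v => PiLp.ext fun i => isEmptyElim i
  have hgrad : ∀ x : UnitAddTorus d, gradient (fun _ : UnitAddTorus d => (1 : ℝ)) x = 0 := fun x => hvec _
  -- conservation of the mean: `W t = w₀` for a.e. `t ∈ (0,T)`
  have hmean : ∀ᵐ t ∂(volume.restrict (Ioo 0 T)), W t = w₀ := by
    filter_upwards [hW.ae_integral_mul_eq (isSmooth_const (1 : ℝ))] with t ht
    simp only [mul_one, hgrad, inner_zero_right, zero_mul, add_zero, mul_zero, integral_zero] at ht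
    rw [hint, hint] at ht
    rw [hpt (W t), hpt w₀, ht]
  refine ⟨fun _ => w₀, ?_, fun t _ => hw₀, fun t _ => le_rfl, fun g _ => continuousOn_const, rfl⟩
  refine hW.congr_ae_slice ?_ ?_
  · exact aestronglyMeasurable_stLift_of_uncurry (S := Ioo 0 T) (u := fun _ : ℝ => w₀) hw₀.1.comp_snd
  · filter_upwards [hmean] with t ht
    rw [ht]

end Assembly

/-! ## The discharge -/

section Discharge

variable [DecidableEq d]

/-- **Discharge of `Torus.BardosTitiWiedemann2012_transportExistence`** (Bardos–Titi–Wiedemann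
2012, proof of Cor. 2; DiPerna–Lions 1989, Prop. II.1; De Lellis–Székelyhidi 2010, Lemma 7.1): for
`T > 0`, a bounded measurable velocity on `(0,T) × T^d`, weakly divergence free at a.e. time, and
`w₀ ∈ L²(T^d)`, a weak solution of `∂ₜw + b·∇w = 0` in the DiPerna–Lions class with the weakly
continuous representative, `‖w(t)‖_{L²} ≤ ‖w₀‖_{L²}` on `[0,T]` and `w(0) = w₀` — by vanishing
viscosity (§1) and the representative of §4–§5 in positive dimension, trivially for `d = ∅`.
[cite: BardosTitiWiedemann2012, proof of Cor. 2] -/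
theorem BardosTitiWiedemann2012_transportExistence_holds : BardosTitiWiedemann2012_transportExistence d := by
  intro T hT b hb hdiv w₀ hw₀
  rcases isEmpty_or_nonempty d with hd | hd
  · exact transportExistence_of_isEmpty hT hb hdiv hw₀
  · exact transportExistence_of_memLp_top hT hb hdiv hw₀

end Discharge

end Torus

end Literature.Analysis.FluidPDE

end
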